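import Literature.Analysis.FluidPDE.SerrinEnstrophyGronwallForced
import Literature.Analysis.FluidPDE.BeiraoDaVeigaEnstrophyGronwall
import Literature.Analysis.FluidPDE.MillerMiddleEigenvalueGronwall
import HarnessLib

/-!
# The forcing device for enstrophy inequalities: ANY unforced slice bound
# `∫ Σᵢ⟪∂ᵢv, ∂ᵢ∂ₜv⟫ ≤ κ ∫|∇v|²` becomes `… ≤ κ_{ν/2} ∫|∇v|² + (2ν)⁻¹‖f‖²₂` with a force, and the
# slab Grönwall `∫|∇u(s)|² ≤ (∫|∇u(0)|² + ν⁻¹∫‖f‖²₂) exp(2∫κ)`; instances: Beirão da Veiga and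
# Miller WITH A FORCE

Analysis/FluidPDE proof file (theorems only: no definition, no named fact, no `sorry`). Cell
`ns-blowup`, seat `ns-blowup-ecbridge-2` (g9, E–C endpoint theory). WHAT THIS IS NOT: not a statement
about Navier–Stokes blow-up — a-priori enstrophy bounds for classical solutions of the FORCED system on
a closed slab; consumers are the necessary conditions on the (uninhabited) E–C type `ClayBlowup ν`.

The tree's `SerrinEnstrophyGronwallForced.lean` (Lemarié-Rieusset 2016, Thm. 11.2 (11.11)) adds a
force to Serrin's enstrophy inequality by ONE device: split the viscosity `ν = ν/2 + ν/2`; with the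
forced momentum equation `W + (v·∇)v = νΔv − ∇q + f` the field `W₁ = W − (ν/2)Δv − f` satisfies
the UNFORCED momentum equation at viscosity `ν/2`, so any unforced slice bound applies to it, while
`∫ Σᵢ⟪∂ᵢv, ∂ᵢ((ν/2)Δv + f)⟫ = −(ν/2)‖Δv‖² − ∫⟪Δv, f⟫ ≤ (2ν)⁻¹‖f‖²₂` pointwise. This file states
the device ONCE for an ABSTRACT unforced slice bound (`integral_sum_inner_fderiv_le_of_momentum_forced_of_unforced`:
hypothesis `hunf` = "every `C¹ ∩ H¹` field solving the unforced momentum equation at `ν/2` obeys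
`∫ Σᵢ⟪∂ᵢv, ∂ᵢW₁⟫ ≤ K ∫|∇v|²_F`"; conclusion `∫ Σᵢ⟪∂ᵢv, ∂ᵢW⟫ ≤ K ∫|∇v|²_F + (2ν)⁻¹ ∫|f|²`), runs
the slab Grönwall of the Serrin file with an abstract a.e.-in-time coefficient `κ(t) ≥ 0`,
`∫₀ˢ κ < ∞` (`enstrophy_le_mul_exp_forced_of_unforced`:
`∫|∇u(s)|² ≤ exp(2∫₀ˢ κ) (∫|∇u(0)|² + ν⁻¹∫₀ˢ F)`, `F ≥ ‖f(·)‖²₂` measurable), and instantiates it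
with the two unforced slice bounds the tree already proves:

* **Beirão da Veiga with a force** (`bdv_enstrophy_le_mul_exp_forced`; Beirão da Veiga 1995,
  Berselli–Galdi 2002 (1.3); slice bound `integral_sum_inner_fderiv_le_of_momentum_of_gradient_eLpNorm`):
  `κ(t) = C(θ) (ν/2)^{1−q} ‖∇u(t)‖_{L^r}^q`, `2/q + 3/r = 2`, `3/2 < r < ∞`;
* **Miller's middle eigenvalue with a force** (`miller_enstrophy_le_mul_exp_forced`; Miller 2020,
  Thm. 1.1; slice bound `integral_sum_inner_fderiv_le_of_momentum_of_midStrain`):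
  `κ(t) = C(θ) 2^{1/θ} (ν/2)^{1−1/θ} ‖m(t)‖_{L^r}^{1/θ}` for any two-frame majorant `m ≥ 0` of the
  middle principal strain, `3/2 < r < ∞`, `θ = 1 − 3/(2r)`.

## Mathlib / tree search

Tree (used): the whole Serrin-programme toolkit cited in place (`lintegral_gronwall_le`,
`IsSmoothSpaceTimeOn.enstrophy_balance`, `integral_sum_inner_fderiv_fderiv_eq_neg_integral_inner_laplacian`,
`integrable_of_norm_le_mul_of_lintegral_sq`, `linfty_bound_of_hasBoundedSobolevNormsOn_holds`,
`exists_forall_norm_fderiv_le_of_hasBoundedSobolevNormsOn`); the unforced slice bounds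
`integral_sum_inner_fderiv_le_of_momentum_of_gradient_eLpNorm` (`BeiraoDaVeigaEnstrophyGronwall`) and
`integral_sum_inner_fderiv_le_of_momentum_of_midStrain` (`MillerMiddleEigenvalueGronwall`).
`lean search 'forced' --decl` in FluidPDE: only Serrin's class had a forced enstrophy inequality
(`serrin_enstrophy_le_mul_exp_forced`); Beirão da Veiga / Miller were unforced only.

## References

* P. G. Lemarié-Rieusset, *The Navier–Stokes Problem in the 21st Century*, CRC (2016), Thm. 11.2
  with (11.9)–(11.11), §11.5 p. 329. [LemarieRieusset2016]
* H. Beirão da Veiga, Chinese Ann. Math. Ser. B 16 (1995) 407–412; L. C. Berselli, G. P. Galdi,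
  Proc. AMS 130 (2002), (1.3) p. 3586. [BeiraoDaVeiga1995] [BerselliGaldi2002]
* E. Miller, Arch. Ration. Mech. Anal. 235 (2020) 99–139 = arXiv:1710.05569, Thm. 1.1. [Miller2019]
-/

noncomputable section

open MeasureTheory Set Function Filter Topology InnerProductSpace
open scoped ENNReal NNReal ContDiff RealInnerProductSpace Laplacian

namespace Literature.Analysis.FluidPDE

/-! ### Two `L²` bookkeeping helpers (private plumbing) -/

section L2

variable {G : Type*} [NormedAddCommGroup G]

/-- `∫⁻ ‖g‖ₑ² < ∞` for `g ∈ L²`. [folklore] -/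
private theorem lintegral_enorm_sq_lt_top_of_memLp_two' {α : Type*} [MeasurableSpace α] {μ : Measure α}
    {g : α → G} (h : MemLp g 2 μ) : ∫⁻ x, ‖g x‖ₑ ^ 2 ∂μ < ⊤ := by
  rw [lintegral_enorm_sq_eq_eLpNorm_two_sq]
  exact ENNReal.pow_lt_top h.eLpNorm_lt_top

/-- A continuous field with `∫⁻ ‖g‖ₑ² < ∞` is in `L²`. [folklore] -/
private theorem memLp_two_of_continuous_of_lintegral' {α : Type*} [MeasurableSpace α] [TopologicalSpace α]
    [OpensMeasurableSpace α] {μ : Measure α} [TopologicalSpace.PseudoMetrizableSpace G]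
    [SecondCountableTopologyEither α G]
    {g : α → G} (hc : Continuous g) (h : ∫⁻ x, ‖g x‖ₑ ^ 2 ∂μ < ⊤) : MemLp g 2 μ :=
  ⟨hc.aestronglyMeasurable, eLpNorm_two_lt_top_of_lintegral_enorm_sq_lt_top h⟩

end L2

/-! ### §1 The device at a fixed time -/

section Slice

/-- **The forcing device for an enstrophy slice bound** (Lemarié-Rieusset 2016, proof of Thm. 11.2,
(11.9): the force costs `(2ν)⁻¹‖f‖²₂` after splitting the viscosity). Let `v ∈ C³(ℝ³; ℝ³)`,
`W, f ∈ C¹`, with the FORCED momentum equation `W + (v·∇)v = νΔv − ∇q + f` (`ν > 0`),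
`Dv, D²v, D³v, W, DW, f, Df ∈ L²`. Suppose every `C¹` field `W₁` with `W₁, DW₁ ∈ L²` solving the
UNFORCED momentum equation at viscosity `ν/2`, `W₁ + (v·∇)v = (ν/2)Δv − ∇q`, obeys
`∫ Σᵢ⟪∂ᵢv, ∂ᵢW₁⟫ ≤ K ∫|∇v|²_F` (an unforced slice bound of the tree, e.g. Serrin's, Beirão da
Veiga's or Miller's, at viscosity `ν/2`). Then `∫ Σᵢ⟪∂ᵢv, ∂ᵢW⟫ ≤ K ∫|∇v|²_F + (2ν)⁻¹ ∫|f|²`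
(`W₁ = W − (ν/2)Δv − f`; `∫ Σᵢ⟪∂ᵢv, ∂ᵢ((ν/2)Δv + f)⟫ = −∫⟪Δv, (ν/2)Δv + f⟫ ≤ (2ν)⁻¹∫|f|²`).
[cite: LemarieRieusset2016, Thm. 11.2 with (11.9)] -/
theorem integral_sum_inner_fderiv_le_of_momentum_forced_of_unforced {ν : ℝ} (hν : 0 < ν)
    {v W f : EuclideanSpace ℝ (Fin 3) → EuclideanSpace ℝ (Fin 3)} {q : EuclideanSpace ℝ (Fin 3) → ℝ}
    (hv : ContDiff ℝ 3 v) (hW : ContDiff ℝ 1 W) (hf : ContDiff ℝ 1 f)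
    (hmom : ∀ x, W x + FluidPDE.convect v v x = ν • (Δ v) x - gradient q x + f x)
    (hv1 : ∫⁻ x, ‖iteratedFDeriv ℝ 1 v x‖ₑ ^ 2 < ⊤) (hv2 : ∫⁻ x, ‖iteratedFDeriv ℝ 2 v x‖ₑ ^ 2 < ⊤)
    (hv3 : ∫⁻ x, ‖iteratedFDeriv ℝ 3 v x‖ₑ ^ 2 < ⊤)
    (hW0 : ∫⁻ x, ‖W x‖ₑ ^ 2 < ⊤) (hW1 : ∫⁻ x, ‖iteratedFDeriv ℝ 1 W x‖ₑ ^ 2 < ⊤)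
    (hf0 : ∫⁻ x, ‖f x‖ₑ ^ 2 < ⊤) (hf1 : ∫⁻ x, ‖iteratedFDeriv ℝ 1 f x‖ₑ ^ 2 < ⊤)
    {Kb : ℝ}
    (hunf : ∀ W₁ : EuclideanSpace ℝ (Fin 3) → EuclideanSpace ℝ (Fin 3), ContDiff ℝ 1 W₁ →
      (∀ x, W₁ x + FluidPDE.convect v v x = (ν / 2) • (Δ v) x - gradient q x) →
      ∫⁻ x, ‖W₁ x‖ₑ ^ 2 < ⊤ → ∫⁻ x, ‖iteratedFDeriv ℝ 1 W₁ x‖ₑ ^ 2 < ⊤ →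
      ∫ x, ∑ i, ⟪fderiv ℝ v x (EuclideanSpace.basisFun (Fin 3) ℝ i),
          fderiv ℝ W₁ x (EuclideanSpace.basisFun (Fin 3) ℝ i)⟫ ≤
        Kb * ∫ x, FluidPDE.frobeniusNormSq (fderiv ℝ v x)) :
    ∫ x, ∑ i, ⟪fderiv ℝ v x (EuclideanSpace.basisFun (Fin 3) ℝ i),
        fderiv ℝ W x (EuclideanSpace.basisFun (Fin 3) ℝ i)⟫ ≤
      Kb * (∫ x, FluidPDE.frobeniusNormSq (fderiv ℝ v x)) + (2 * ν)⁻¹ * ∫ x, ‖f x‖ ^ 2 := by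
  set e := EuclideanSpace.basisFun (Fin 3) ℝ with he
  have he1 : ∀ i, ‖e i‖ = 1 := fun i => by simp [he]
  have hν2 : 0 < ν / 2 := half_pos hν
  -- regularity
  have hv2' : ContDiff ℝ 2 v := hv.of_le (by norm_num)
  have hΔ1 : ContDiff ℝ 1 (Δ v) := contDiff_one_laplacian_of_contDiff_three hv
  -- the auxiliary fields `g = (ν/2) Δv + f` and `W₁ = W - g`
  set g : EuclideanSpace ℝ (Fin 3) → EuclideanSpace ℝ (Fin 3) := fun x => (ν / 2) • (Δ v) x + f x
    with hg
  set W₁ : EuclideanSpace ℝ (Fin 3) → EuclideanSpace ℝ (Fin 3) := fun x => W x - g x with hW₁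
  have hgC : ContDiff ℝ 1 g := (hΔ1.const_smul (ν / 2)).add hf
  have hW₁C : ContDiff ℝ 1 W₁ := hW.sub hgC
  have hWsplit : W = fun y => W₁ y + g y := by
    funext y; simp only [hW₁, sub_add_cancel]
  have hmom₁ : ∀ x, W₁ x + FluidPDE.convect v v x = (ν / 2) • (Δ v) x - gradient q x := by
    intro x
    have h2 : ν • (Δ v) x = (ν / 2) • (Δ v) x + (ν / 2) • (Δ v) x := by
      rw [← add_smul]; ring_nf
    simp only [hW₁, hg]
    rw [sub_add_eq_add_sub, hmom x, h2]
    abel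
  -- continuity
  have cv : Continuous v := hv.continuous
  have cDv : Continuous (fderiv ℝ v) := hv.continuous_fderiv (by norm_num)
  have cD2 : Continuous fun x => iteratedFDeriv ℝ 2 v x := hv.continuous_iteratedFDeriv (by norm_num)
  have cD3 : Continuous fun x => iteratedFDeriv ℝ 3 v x := hv.continuous_iteratedFDeriv (by norm_num)
  have cdiv : ∀ i, Continuous fun x => fderiv ℝ v x (e i) := fun i => cDv.clm_apply continuous_const
  have cddv : ∀ i, Continuous fun x => fderiv ℝ (fun y => fderiv ℝ v y (e i)) x (e i) := fun i =>
    ((((hv.fderiv_right (m := 2) (by norm_num)).clm_apply contDiff_const).continuous_fderiv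
      (by norm_num)).clm_apply continuous_const)
  have cΔ : Continuous (Δ v) := hΔ1.continuous
  have cDΔ : Continuous (fderiv ℝ (Δ v)) := hΔ1.continuous_fderiv one_ne_zero
  have cf : Continuous f := hf.continuous
  have cDf : Continuous (fderiv ℝ f) := hf.continuous_fderiv one_ne_zero
  have cW : Continuous W := hW.continuous
  have cDW : Continuous (fderiv ℝ W) := hW.continuous_fderiv one_ne_zero
  have cg : Continuous g := hgC.continuous
  have cDg : Continuous (fderiv ℝ g) := hgC.continuous_fderiv one_ne_zero
  have cW₁ : Continuous W₁ := hW₁C.continuous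
  have cDW₁ : Continuous (fderiv ℝ W₁) := hW₁C.continuous_fderiv one_ne_zero
  have cdig : ∀ i, Continuous fun x => fderiv ℝ g x (e i) := fun i => cDg.clm_apply continuous_const
  have cdiW₁ : ∀ i, Continuous fun x => fderiv ℝ W₁ x (e i) := fun i =>
    cDW₁.clm_apply continuous_const
  -- pointwise norm identities and bounds
  have hD1_eq : ∀ (φ : EuclideanSpace ℝ (Fin 3) → EuclideanSpace ℝ (Fin 3)) x,
      ‖fderiv ℝ φ x‖ = ‖iteratedFDeriv ℝ 1 φ x‖ := fun φ x => by
    rw [← norm_iteratedFDeriv_fderiv, norm_iteratedFDeriv_zero]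
  have n_Δ : ∀ x, ‖(Δ v) x‖ ≤ ‖(3 : ℝ) • iteratedFDeriv ℝ 2 v x‖ := fun x => by
    rw [norm_smul, Real.norm_of_nonneg (by norm_num : (0 : ℝ) ≤ 3)]
    exact norm_laplacian_le_three_mul_norm_iteratedFDeriv_two hv2' x
  have n_dΔ : ∀ i x, ‖fderiv ℝ (Δ v) x (e i)‖ ≤ 3 * ‖iteratedFDeriv ℝ 3 v x‖ := fun i x => by
    rw [fderiv_laplacian_apply_of_contDiff_three hv x (e i)]
    exact (norm_laplacian_le_three_mul_norm_iteratedFDeriv_two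
      ((hv.fderiv_right (m := 2) (by norm_num)).clm_apply contDiff_const) x).trans
      (mul_le_mul_of_nonneg_left (norm_iteratedFDeriv_fderiv_apply_basisFun_le hv 2 (by norm_num) x i)
        (by norm_num))
  have n_DΔ : ∀ x, ‖fderiv ℝ (Δ v) x‖ ≤ ‖(6 : ℝ) • iteratedFDeriv ℝ 3 v x‖ := by
    intro x
    have hsq : ‖fderiv ℝ (Δ v) x‖ ^ 2 ≤ ∑ i, ‖fderiv ℝ (Δ v) x (e i)‖ ^ 2 :=
      FluidPDE.sq_opNorm_le_sum_sq_norm_apply e _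
    have h2 : ∑ i, ‖fderiv ℝ (Δ v) x (e i)‖ ^ 2 ≤
        ∑ _i : Fin 3, (3 * ‖iteratedFDeriv ℝ 3 v x‖) ^ 2 :=
      Finset.sum_le_sum fun i _ => pow_le_pow_left₀ (norm_nonneg _) (n_dΔ i x) 2
    rw [Finset.sum_const, Finset.card_univ, Fintype.card_fin, nsmul_eq_mul] at h2
    rw [norm_smul, Real.norm_of_nonneg (by norm_num : (0 : ℝ) ≤ 6)]
    have h0 : 0 ≤ ‖iteratedFDeriv ℝ 3 v x‖ := norm_nonneg _
    have h3 : ‖fderiv ℝ (Δ v) x‖ ^ 2 ≤ (6 * ‖iteratedFDeriv ℝ 3 v x‖) ^ 2 := by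
      push_cast at h2
      nlinarith [hsq, h2]
    exact (pow_le_pow_iff_left₀ (norm_nonneg _) (by positivity) two_ne_zero).1 h3
  -- finite `L²` norms (as lower integrals) and `L²` memberships
  have l2smul : ∀ (c : ℝ) (n : ℕ), ∫⁻ x, ‖iteratedFDeriv ℝ n v x‖ₑ ^ 2 < ⊤ →
      ∫⁻ x, ‖c • iteratedFDeriv ℝ n v x‖ₑ ^ 2 < ⊤ := by
    intro c n hn
    have : ∀ x, ‖c • iteratedFDeriv ℝ n v x‖ₑ ^ 2 =
        ENNReal.ofReal (|c| ^ 2) * ‖iteratedFDeriv ℝ n v x‖ₑ ^ 2 := by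
      intro x
      rw [enorm_smul, mul_pow, ← Real.enorm_abs c, Real.enorm_eq_ofReal (abs_nonneg c),
        ENNReal.ofReal_pow (abs_nonneg c)]
    simp_rw [this]
    rw [lintegral_const_mul' _ _ ENNReal.ofReal_ne_top]
    exact ENNReal.mul_lt_top ENNReal.ofReal_lt_top hn
  have l2Δ3 : ∫⁻ x, ‖(3 : ℝ) • iteratedFDeriv ℝ 2 v x‖ₑ ^ 2 < ⊤ := l2smul 3 2 hv2
  have lΔ : ∫⁻ x, ‖(Δ v) x‖ₑ ^ 2 < ⊤ := lintegral_enorm_sq_lt_top_of_norm_le n_Δ l2Δ3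
  have lDΔ : ∫⁻ x, ‖fderiv ℝ (Δ v) x‖ₑ ^ 2 < ⊤ :=
    lintegral_enorm_sq_lt_top_of_norm_le n_DΔ (l2smul 6 3 hv3)
  have lDv : ∫⁻ x, ‖fderiv ℝ v x‖ₑ ^ 2 < ⊤ :=
    lintegral_enorm_sq_lt_top_of_norm_le (fun x => (hD1_eq v x).le) hv1
  have lDW : ∫⁻ x, ‖fderiv ℝ W x‖ₑ ^ 2 < ⊤ :=
    lintegral_enorm_sq_lt_top_of_norm_le (fun x => (hD1_eq W x).le) hW1
  have lDf : ∫⁻ x, ‖fderiv ℝ f x‖ₑ ^ 2 < ⊤ :=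
    lintegral_enorm_sq_lt_top_of_norm_le (fun x => (hD1_eq f x).le) hf1
  have mΔ : MemLp (Δ v) 2 volume := memLp_two_of_continuous_of_lintegral' cΔ lΔ
  have mf : MemLp f 2 volume := memLp_two_of_continuous_of_lintegral' cf hf0
  have mW : MemLp W 2 volume := memLp_two_of_continuous_of_lintegral' cW hW0
  have mg : MemLp g 2 volume := (mΔ.const_smul (ν / 2)).add mf
  have mW₁ : MemLp W₁ 2 volume := mW.sub mg
  have l2g : ∫⁻ x, ‖g x‖ₑ ^ 2 < ⊤ := lintegral_enorm_sq_lt_top_of_memLp_two' mg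
  have l2W₁ : ∫⁻ x, ‖W₁ x‖ₑ ^ 2 < ⊤ := lintegral_enorm_sq_lt_top_of_memLp_two' mW₁
  -- derivatives of `g` and `W₁`
  have hDg_eq : fderiv ℝ g = fun x => (ν / 2) • fderiv ℝ (Δ v) x + fderiv ℝ f x := by
    funext x
    have h1 : HasFDerivAt (Δ v) (fderiv ℝ (Δ v) x) x :=
      (hΔ1.differentiable one_ne_zero x).hasFDerivAt
    have h2 : HasFDerivAt f (fderiv ℝ f x) x := (hf.differentiable one_ne_zero x).hasFDerivAt
    exact ((h1.const_smul (ν / 2)).add h2).fderiv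
  have hDW₁_eq : fderiv ℝ W₁ = fun x => fderiv ℝ W x - fderiv ℝ g x := by
    funext x
    simp only [hW₁]
    exact fderiv_fun_sub (hW.differentiable one_ne_zero x) (hgC.differentiable one_ne_zero x)
  have mDg : MemLp (fderiv ℝ g) 2 volume := by
    rw [hDg_eq]
    exact ((memLp_two_of_continuous_of_lintegral' cDΔ lDΔ).const_smul (ν / 2)).add
      (memLp_two_of_continuous_of_lintegral' cDf lDf)
  have mDW₁ : MemLp (fderiv ℝ W₁) 2 volume := by
    rw [hDW₁_eq]
    exact (memLp_two_of_continuous_of_lintegral' cDW lDW).sub mDg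
  have lDg : ∫⁻ x, ‖fderiv ℝ g x‖ₑ ^ 2 < ⊤ := lintegral_enorm_sq_lt_top_of_memLp_two' mDg
  have lDW₁ : ∫⁻ x, ‖fderiv ℝ W₁ x‖ₑ ^ 2 < ⊤ := lintegral_enorm_sq_lt_top_of_memLp_two' mDW₁
  have hW₁1 : ∫⁻ x, ‖iteratedFDeriv ℝ 1 W₁ x‖ₑ ^ 2 < ⊤ :=
    lintegral_enorm_sq_lt_top_of_norm_le (fun x => (hD1_eq W₁ x).symm.le) lDW₁
  have ldiv : ∀ i, ∫⁻ x, ‖fderiv ℝ v x (e i)‖ₑ ^ 2 < ⊤ := fun i =>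
    lintegral_enorm_sq_lt_top_of_norm_le (fun x => by
      simpa [he1] using (fderiv ℝ v x).le_opNorm (e i)) lDv
  have ldig : ∀ i, ∫⁻ x, ‖fderiv ℝ g x (e i)‖ₑ ^ 2 < ⊤ := fun i =>
    lintegral_enorm_sq_lt_top_of_norm_le (fun x => by
      simpa [he1] using (fderiv ℝ g x).le_opNorm (e i)) lDg
  have ldiW₁ : ∀ i, ∫⁻ x, ‖fderiv ℝ W₁ x (e i)‖ₑ ^ 2 < ⊤ := fun i =>
    lintegral_enorm_sq_lt_top_of_norm_le (fun x => by
      simpa [he1] using (fderiv ℝ W₁ x).le_opNorm (e i)) lDW₁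
  have lddv : ∀ i, ∫⁻ x, ‖fderiv ℝ (fun y => fderiv ℝ v y (e i)) x (e i)‖ₑ ^ 2 < ⊤ := fun i =>
    lintegral_enorm_sq_lt_top_of_norm_le (fun x => norm_fderiv_fderiv_apply_basisFun_le hv2' x i) hv2
  -- integrability of the products
  have i2W₁ : ∀ i, Integrable (fun x => ⟪fderiv ℝ v x (e i), fderiv ℝ W₁ x (e i)⟫) volume :=
    fun i => integrable_of_norm_le_mul_of_lintegral_sq ((cdiv i).inner (cdiW₁ i)).aestronglyMeasurable
      (cdiv i) (cdiW₁ i) (ldiv i) (ldiW₁ i) fun x => norm_inner_le_norm _ _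
  have i1g : ∀ i, Integrable (fun x => ⟪fderiv ℝ (fun y => fderiv ℝ v y (e i)) x (e i), g x⟫)
      volume := fun i =>
    integrable_of_norm_le_mul_of_lintegral_sq ((cddv i).inner cg).aestronglyMeasurable (cddv i) cg
      (lddv i) l2g fun x => norm_inner_le_norm _ _
  have i2g : ∀ i, Integrable (fun x => ⟪fderiv ℝ v x (e i), fderiv ℝ g x (e i)⟫) volume := fun i =>
    integrable_of_norm_le_mul_of_lintegral_sq ((cdiv i).inner (cdig i)).aestronglyMeasurable
      (cdiv i) (cdig i) (ldiv i) (ldig i) fun x => norm_inner_le_norm _ _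
  have i3g : ∀ i, Integrable (fun x => ⟪fderiv ℝ v x (e i), g x⟫) volume := fun i =>
    integrable_of_norm_le_mul_of_lintegral_sq ((cdiv i).inner cg).aestronglyMeasurable (cdiv i) cg
      (ldiv i) l2g fun x => norm_inner_le_norm _ _
  have iΔg : Integrable (fun x => ⟪(Δ v) x, g x⟫) volume :=
    integrable_of_norm_le_mul_of_lintegral_sq (cΔ.inner cg).aestronglyMeasurable cΔ cg lΔ l2g
      fun x => norm_inner_le_norm _ _
  have iff : Integrable (fun x => ‖f x‖ ^ 2) volume :=
    FluidPDE.integrable_sq_norm_of_lintegral_lt_top cf hf0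
  -- Step 1: the unforced slice bound for `W₁` at viscosity `ν/2`
  have hsl := hunf W₁ hW₁C hmom₁ l2W₁ hW₁1
  -- Step 2: split `∫ Σᵢ ⟪∂ᵢv, ∂ᵢW⟫ = ∫ Σᵢ ⟪∂ᵢv, ∂ᵢW₁⟫ + ∫ Σᵢ ⟪∂ᵢv, ∂ᵢg⟫`
  have hsplit : ∫ x, ∑ i, ⟪fderiv ℝ v x (e i), fderiv ℝ W x (e i)⟫ =
      (∫ x, ∑ i, ⟪fderiv ℝ v x (e i), fderiv ℝ W₁ x (e i)⟫) +
        ∫ x, ∑ i, ⟪fderiv ℝ v x (e i), fderiv ℝ g x (e i)⟫ := by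
    rw [← integral_add (integrable_finsetSum _ fun i _ => i2W₁ i)
      (integrable_finsetSum _ fun i _ => i2g i)]
    refine integral_congr_ae (Eventually.of_forall fun x => ?_)
    have hD : fderiv ℝ W x = fderiv ℝ W₁ x + fderiv ℝ g x := by
      rw [hWsplit]
      exact fderiv_fun_add (hW₁C.differentiable one_ne_zero x) (hgC.differentiable one_ne_zero x)
    simp only
    rw [← Finset.sum_add_distrib]
    refine Finset.sum_congr rfl fun i _ => ?_
    have hD' : fderiv ℝ W x (e i) = fderiv ℝ W₁ x (e i) + fderiv ℝ g x (e i) := by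
      rw [hD]; rfl
    rw [hD', inner_add_right]
  -- Step 3: `∫ Σᵢ ⟪∂ᵢv, ∂ᵢg⟫ = -∫ ⟪Δv, g⟫ ≤ (2ν)⁻¹ ∫ |f|²`
  have hL := integral_sum_inner_fderiv_fderiv_eq_neg_integral_inner_laplacian hv2' hgC i1g i2g i3g
  have hpt : ∀ x, -⟪(Δ v) x, g x⟫ ≤ (2 * ν)⁻¹ * ‖f x‖ ^ 2 := by
    intro x
    have hid : ⟪(Δ v) x, g x⟫ = ν / 2 * ‖(Δ v) x‖ ^ 2 + ⟪(Δ v) x, f x⟫ := by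
      simp only [hg]
      rw [inner_add_right, inner_smul_right, real_inner_self_eq_norm_sq]
    have hcs : -⟪(Δ v) x, f x⟫ ≤ ‖(Δ v) x‖ * ‖f x‖ := by
      have h := (abs_le.1 (abs_real_inner_le_norm ((Δ v) x) (f x))).1
      linarith
    have habs : ∀ X Y : ℝ, X * Y ≤ ν / 2 * X ^ 2 + (2 * ν)⁻¹ * Y ^ 2 := by
      intro X Y
      have h1 : 0 ≤ (2 * ν)⁻¹ * (Y - ν * X) ^ 2 := by positivity
      have e1 : (2 * ν)⁻¹ * (Y - ν * X) ^ 2 = (2 * ν)⁻¹ * Y ^ 2 - X * Y + ν / 2 * X ^ 2 := by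
        field_simp
        ring
      linarith
    have hY := habs ‖(Δ v) x‖ ‖f x‖
    rw [hid]
    linarith
  have hint : ∫ x, -⟪(Δ v) x, g x⟫ ≤ (2 * ν)⁻¹ * ∫ x, ‖f x‖ ^ 2 := by
    rw [← integral_const_mul]
    exact integral_mono iΔg.neg (iff.const_mul _) hpt
  have hneg_int : ∫ x, -⟪(Δ v) x, g x⟫ = - ∫ x, ⟪(Δ v) x, g x⟫ := integral_neg _
  -- Step 4: conclude
  rw [hsplit, hL, ← hneg_int]
  linarith [hsl, hint]

end Slice

/-! ### §2 The slab Grönwall with a force, abstract coefficient -/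

section Slab

/-- **The forced enstrophy inequality on a slab, for an abstract unforced slice bound**
(Lemarié-Rieusset 2016, Thm. 11.2, (11.11) with the Serrin coefficient replaced by any `κ(t) ≥ 0`).
Let `(u, p)` be a classical solution of the FORCED system on `[0, T] × ℝ³` (`ν > 0`) in Tao's class
(`u`, `∂ₜu`, `p` with all `L²` Sobolev norms bounded on the slab), `f(t), Df(t) ∈ L²` uniformly,
`F ≥ ‖f(·)‖²₂` a measurable majorant, `0 < s ≤ T`. If for a.e. `t ∈ (0, s)` every `C¹ ∩ H¹` field
`W₁` solving the unforced momentum equation at viscosity `ν/2` at the slice `u(t)` obeys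
`∫ Σᵢ⟪∂ᵢu(t), ∂ᵢW₁⟫ ≤ a(t) ∫|∇u(t)|²_F` whenever the `ℝ≥0∞`-valued density `a(t)` is finite (at times
of infinite density nothing is asked: there the Grönwall comparison is free, the production vanishing
with the enstrophy), with `∫₀ˢ a < ∞` and `∫₀ˢ F < ∞`, then
`∫|∇u(s)|²_F ≤ exp(2 ∫₀ˢ a) · (∫|∇u(0)|²_F + ν⁻¹ ∫₀ˢ F)`.
Proof: `IsSmoothSpaceTimeOn.enstrophy_balance`, the device
`integral_sum_inner_fderiv_le_of_momentum_forced_of_unforced` at a.e. interior time, and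
`lintegral_gronwall_le` with the `L¹` kernel `2κ`. [cite: LemarieRieusset2016, Thm. 11.2 (11.11)] -/
theorem enstrophy_le_mul_exp_forced_of_unforced {ν T : ℝ} (hν : 0 < ν) (hT : 0 < T)
    {u f : ℝ → EuclideanSpace ℝ (Fin 3) → EuclideanSpace ℝ (Fin 3)}
    {p : ℝ → EuclideanSpace ℝ (Fin 3) → ℝ} (hsol : FluidPDE.IsClassicalNSSolutionOn (Icc 0 T) ν f u p)
    (hu : HasBoundedSobolevNormsOn (Icc 0 T) u)
    (hut : HasBoundedSobolevNormsOn (Icc 0 T) (FluidPDE.timeDerivWithin (Icc 0 T) u))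
    (hp : ∀ n : ℕ, ∃ C : ℝ≥0, ∀ t ∈ Icc 0 T, ∫⁻ x, ‖iteratedFDeriv ℝ n (p t) x‖ₑ ^ 2 ≤ C)
    (hf : ∀ n : ℕ, n ≤ 1 → ∃ C : ℝ≥0, ∀ t ∈ Icc 0 T, ∫⁻ x, ‖iteratedFDeriv ℝ n (f t) x‖ₑ ^ 2 ≤ C)
    (F : ℝ → ℝ≥0∞) (hFm : Measurable F) (hF : ∀ t ∈ Ioo 0 T, ∫⁻ x, ‖f t x‖ₑ ^ 2 ≤ F t)
    {s : ℝ} (hs : s ∈ Ioc 0 T) {a : ℝ → ℝ≥0∞}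
    (hunf : ∀ᵐ t ∂volume, t ∈ Ioo 0 s → a t ≠ ⊤ →
      ∀ W₁ : EuclideanSpace ℝ (Fin 3) → EuclideanSpace ℝ (Fin 3), ContDiff ℝ 1 W₁ →
        (∀ x, W₁ x + FluidPDE.convect (u t) (u t) x = (ν / 2) • (Δ (u t)) x - gradient (p t) x) →
        ∫⁻ x, ‖W₁ x‖ₑ ^ 2 < ⊤ → ∫⁻ x, ‖iteratedFDeriv ℝ 1 W₁ x‖ₑ ^ 2 < ⊤ →
        ∫ x, ∑ i, ⟪fderiv ℝ (u t) x (EuclideanSpace.basisFun (Fin 3) ℝ i),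
            fderiv ℝ W₁ x (EuclideanSpace.basisFun (Fin 3) ℝ i)⟫ ≤
          (a t).toReal * ∫ x, FluidPDE.frobeniusNormSq (fderiv ℝ (u t) x))
    (hA : ∫⁻ t in Ioo 0 s, a t ≠ ⊤)
    (hFs : ∫⁻ t in Ioo 0 s, F t ≠ ⊤) :
    ∫⁻ x, ENNReal.ofReal (FluidPDE.frobeniusNormSq (fderiv ℝ (u s) x)) ≤
      ENNReal.ofReal (Real.exp (2 * (∫⁻ t in Ioo 0 s, a t).toReal)) *
        ((∫⁻ x, ENNReal.ofReal (FluidPDE.frobeniusNormSq (fderiv ℝ (u 0) x))) +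
          (ENNReal.ofReal ν)⁻¹ * ∫⁻ t in Ioo 0 s, F t) := by
  set e := EuclideanSpace.basisFun (Fin 3) ℝ with he
  have hU : UniqueDiffOn ℝ (Icc 0 T) := uniqueDiffOn_Icc hT
  set W : ℝ → EuclideanSpace ℝ (Fin 3) → EuclideanSpace ℝ (Fin 3) :=
    FluidPDE.timeDerivWithin (Icc 0 T) u with hW
  have hWsm : FluidPDE.IsSmoothSpaceTimeOn (Icc 0 T) W := hsol.smooth_velocity.timeDerivWithin hU
  obtain ⟨C₀, hC₀⟩ := hu 0
  obtain ⟨C₁, hC₁⟩ := hu 1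
  obtain ⟨D₂, hD₂⟩ := hu 2
  obtain ⟨D₃, hD₃⟩ := hu 3
  obtain ⟨E₀, hE₀⟩ := hut 0
  obtain ⟨E₁, hE₁⟩ := hut 1
  obtain ⟨P₀, hP₀⟩ := hp 0
  obtain ⟨P₁, hP₁⟩ := hp 1
  obtain ⟨F₀, hF₀⟩ := hf 0 zero_le_one
  obtain ⟨F₁, hF₁⟩ := hf 1 le_rfl
  have hzero : ∀ {φ : EuclideanSpace ℝ (Fin 3) → EuclideanSpace ℝ (Fin 3)} {C' : ℝ≥0},
      (∫⁻ x, ‖iteratedFDeriv ℝ 0 φ x‖ₑ ^ 2 ≤ C') → ∫⁻ x, ‖φ x‖ₑ ^ 2 < ⊤ := by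
    intro φ C' h
    refine lt_of_le_of_lt ((le_of_eq (lintegral_congr fun x => ?_)).trans h) ENNReal.coe_lt_top
    rw [← ofReal_norm, ← ofReal_norm, norm_iteratedFDeriv_zero]
  have hzero' : ∀ {φ : EuclideanSpace ℝ (Fin 3) → ℝ} {C' : ℝ≥0},
      (∫⁻ x, ‖iteratedFDeriv ℝ 0 φ x‖ₑ ^ 2 ≤ C') → ∫⁻ x, ‖φ x‖ₑ ^ 2 < ⊤ := by
    intro φ C' h
    refine lt_of_le_of_lt ((le_of_eq (lintegral_congr fun x => ?_)).trans h) ENNReal.coe_lt_top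
    rw [← ofReal_norm, ← ofReal_norm, norm_iteratedFDeriv_zero]
  -- the force slices are `C¹` (read off the momentum equation)
  have hfC : ∀ t ∈ Icc 0 T, ContDiff ℝ 1 (f t) := by
    intro t ht
    have hu3 : ContDiff ℝ 3 (u t) := (hsol.contDiff_velocity ht).of_le (by norm_cast)
    have hu2 : ContDiff ℝ 2 (u t) := (hsol.contDiff_velocity ht).of_le (by norm_cast)
    have hp2 : ContDiff ℝ 2 (p t) := (hsol.contDiff_pressure ht).of_le (by norm_cast)
    have hWC : ContDiff ℝ 1 (W t) := (hWsm.contDiff_slice ht).of_le (by norm_cast)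
    have hconvC : ContDiff ℝ 1 (FluidPDE.convect (u t) (u t)) := by
      have : FluidPDE.convect (u t) (u t) = fun x => fderiv ℝ (u t) x (u t x) := rfl
      rw [this]
      exact (hu2.fderiv_right (m := 1) (by norm_num)).clm_apply (hu2.of_le (by norm_num))
    have hΔC : ContDiff ℝ 1 (Δ (u t)) := contDiff_one_laplacian_of_contDiff_three hu3
    have hgradC : ContDiff ℝ 1 (gradient (p t)) := by
      have : gradient (p t) = fun x => (InnerProductSpace.toDual ℝ _).symm (fderiv ℝ (p t) x) := rfl
      rw [this]
      exact (InnerProductSpace.toDual ℝ (EuclideanSpace ℝ (Fin 3))).symm.contDiff.comp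
        (hp2.fderiv_right (m := 1) (by norm_num))
    have hfeq : f t = fun x => (W t x + FluidPDE.convect (u t) (u t) x) -
        (ν • (Δ (u t)) x - gradient (p t) x) := by
      funext x
      have h := hsol.momentum t ht x
      exact eq_sub_of_add_eq' h.symm
    rw [hfeq]
    exact (hWC.add hconvC).sub ((hΔC.const_smul ν).sub hgradC)
  -- the enstrophy balance
  obtain ⟨hΦint, hGcont, hGb⟩ := hsol.smooth_velocity.enstrophy_balance hT hC₁ hE₁
  set Φ : ℝ → ℝ := fun t => ∫ x, 2 * ∑ i, ⟪fderiv ℝ (u t) x (e i), fderiv ℝ (W t) x (e i)⟫ with hΦ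
  set G : ℝ → ℝ := fun t => ∫ x, FluidPDE.frobeniusNormSq (fderiv ℝ (u t) x) with hG
  have hG0 : ∀ t, 0 ≤ G t := fun t => integral_nonneg fun x => FluidPDE.frobeniusNormSq_nonneg _
  have hfrob_le : ∀ t ∈ Icc 0 T,
      ∫⁻ x, ENNReal.ofReal (FluidPDE.frobeniusNormSq (fderiv ℝ (u t) x)) ≤ 3 * C₁ := by
    intro t ht
    calc ∫⁻ x, ENNReal.ofReal (FluidPDE.frobeniusNormSq (fderiv ℝ (u t) x))
        ≤ ∫⁻ x, 3 * ‖iteratedFDeriv ℝ 1 (u t) x‖ₑ ^ 2 := lintegral_mono fun x => by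
          rw [← ofReal_norm, norm_iteratedFDeriv_one, ofReal_norm]
          exact ofReal_frobeniusNormSq_le_three_mul_enorm_sq _
      _ = 3 * ∫⁻ x, ‖iteratedFDeriv ℝ 1 (u t) x‖ₑ ^ 2 := lintegral_const_mul' _ _ (by norm_num)
      _ ≤ 3 * C₁ := by gcongr; exact hC₁ t ht
  have hfrob_lt : ∀ t ∈ Icc 0 T,
      ∫⁻ x, ENNReal.ofReal (FluidPDE.frobeniusNormSq (fderiv ℝ (u t) x)) < ⊤ := fun t ht =>
    lt_of_le_of_lt (hfrob_le t ht) (ENNReal.mul_lt_top (by norm_num) ENNReal.coe_lt_top)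
  have ifrob : ∀ t ∈ Icc 0 T,
      Integrable (fun x => FluidPDE.frobeniusNormSq (fderiv ℝ (u t) x)) volume :=
    fun t ht => integrable_of_continuous_of_nonneg
      (FluidPDE.continuous_frobeniusNormSq_fderiv (hsol.contDiff_velocity ht) (by simp))
      (fun x => FluidPDE.frobeniusNormSq_nonneg _) (hfrob_lt t ht)
  have hGeq : ∀ t ∈ Icc 0 T, ENNReal.ofReal (G t) =
      ∫⁻ x, ENNReal.ofReal (FluidPDE.frobeniusNormSq (fderiv ℝ (u t) x)) := fun t ht =>
    ofReal_integral_eq_lintegral_ofReal (ifrob t ht)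
      (Eventually.of_forall fun x => FluidPDE.frobeniusNormSq_nonneg _)
  -- the square `L²` norm of the force slice as a real integral
  have hf2 : ∀ t ∈ Icc 0 T, ∫⁻ x, ‖f t x‖ₑ ^ 2 < ⊤ := fun t ht => hzero (hF₀ t ht)
  have hfsq : ∀ t ∈ Icc 0 T,
      ENNReal.ofReal (∫ x, ‖f t x‖ ^ 2) = ∫⁻ x, ‖f t x‖ₑ ^ 2 := by
    intro t ht
    rw [ofReal_integral_eq_lintegral_ofReal
      (FluidPDE.integrable_sq_norm_of_lintegral_lt_top (hfC t ht).continuous (hf2 t ht))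
      (Eventually.of_forall fun x => sq_nonneg _)]
    refine lintegral_congr fun x => ?_
    rw [← ofReal_norm, ENNReal.ofReal_pow (norm_nonneg _)]
  -- the forced production bound at a.e. interior time: `Φ t ≤ 2 κ(t) G t + ν⁻¹ ‖f t‖²`
  have hslice : ∀ᵐ t ∂volume, t ∈ Ioo 0 s → a t ≠ ⊤ →
      Φ t ≤ 2 * (a t).toReal * G t + ν⁻¹ * ∫ x, ‖f t x‖ ^ 2 := by
    filter_upwards [hunf] with t hunft hts hat
    have ht : t ∈ Ioo 0 T := ⟨hts.1, hts.2.trans_le hs.2⟩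
    have htI : t ∈ Icc 0 T := Ioo_subset_Icc_self ht
    have hmom : ∀ x, W t x + FluidPDE.convect (u t) (u t) x =
        ν • (Δ (u t)) x - gradient (p t) x + f t x := by
      intro x
      have h := hsol.momentum t htI x
      simpa [hW] using h
    have hsl := integral_sum_inner_fderiv_le_of_momentum_forced_of_unforced hν
      ((hsol.contDiff_velocity htI).of_le (by norm_cast))
      ((hWsm.contDiff_slice htI).of_le (by norm_cast)) (hfC t htI) hmom
      ((hC₁ t htI).trans_lt ENNReal.coe_lt_top) ((hD₂ t htI).trans_lt ENNReal.coe_lt_top)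
      ((hD₃ t htI).trans_lt ENNReal.coe_lt_top)
      (hzero (hE₀ t htI)) ((hE₁ t htI).trans_lt ENNReal.coe_lt_top)
      (hf2 t htI) ((hF₁ t htI).trans_lt ENNReal.coe_lt_top) (hunft hts hat)
    have h2 : Φ t = 2 * ∫ x, ∑ i, ⟪fderiv ℝ (u t) x (e i), fderiv ℝ (W t) x (e i)⟫ := by
      rw [hΦ]
      exact integral_const_mul _ _
    rw [h2]
    have := mul_le_mul_of_nonneg_left hsl (zero_le_two (α := ℝ))
    refine this.trans_eq ?_
    simp only [hG]
    ring
  -- at a time of zero enstrophy the production vanishes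
  have hbad : ∀ τ ∈ Icc 0 T, G τ = 0 → Φ τ = 0 := by
    intro τ hτ hGz
    have hcu : Continuous fun x => FluidPDE.frobeniusNormSq (fderiv ℝ (u τ) x) :=
      FluidPDE.continuous_frobeniusNormSq_fderiv (hsol.contDiff_velocity hτ) (by simp)
    have hae := (integral_eq_zero_iff_of_nonneg (fun x => FluidPDE.frobeniusNormSq_nonneg _)
      (ifrob τ hτ)).1 hGz
    have h0 : (fun x => FluidPDE.frobeniusNormSq (fderiv ℝ (u τ) x)) = 0 :=
      (Continuous.ae_eq_iff_eq volume hcu continuous_zero).1 hae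
    have hD0 : ∀ x, fderiv ℝ (u τ) x = 0 := fun x =>
      (frobeniusNormSq_eq_zero_iff _).1 (by simpa using congrFun h0 x)
    rw [hΦ]
    simp [hD0]
  -- Grönwall in `ℝ≥0∞`
  set φE : ℝ → ℝ≥0∞ := fun t => ENNReal.ofReal (G t) with hφE
  set aE : ℝ → ℝ≥0∞ := fun t => 2 * a t with haE
  set bS : ℝ≥0∞ := ENNReal.ofReal ν⁻¹ * ∫⁻ t in Ioo 0 s, F t with hbS_def
  have hbS : bS ≠ ⊤ := ENNReal.mul_ne_top ENNReal.ofReal_ne_top hFs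
  have hM : ∀ t ∈ Icc 0 s, φE t ≤ 3 * C₁ := fun t ht => by
    rw [hφE]; simp only; rw [hGeq t ⟨ht.1, ht.2.trans hs.2⟩]
    exact hfrob_le t ⟨ht.1, ht.2.trans hs.2⟩
  have haS : ∫⁻ t in Ioo 0 s, aE t ≠ ⊤ := by
    rw [haE]; simp only
    rw [lintegral_const_mul' _ _ (by norm_num : (2 : ℝ≥0∞) ≠ ⊤)]
    exact ENNReal.mul_ne_top (by norm_num) hA
  have hineq : ∀ t ∈ Icc 0 s, φE t ≤ (φE 0 + bS) + ∫⁻ τ in Ioo 0 t, aE τ * φE τ := by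
    intro t ht
    rcases eq_or_lt_of_le ht.1 with h0 | ht0
    · rw [← h0]; simp
    have htT : t ∈ Ioc 0 T := ⟨ht0, ht.2.trans hs.2⟩
    have hΦt : IntegrableOn Φ (Ioo 0 t) volume := hΦint.mono_set (Ioo_subset_Ioo le_rfl htT.2)
    have h1 : ENNReal.ofReal (∫ τ in Ioo 0 t, Φ τ) ≤ ∫⁻ τ in Ioo 0 t, ENNReal.ofReal (Φ τ) := by
      calc ENNReal.ofReal (∫ τ in Ioo 0 t, Φ τ) ≤ ENNReal.ofReal (∫ τ in Ioo 0 t, max (Φ τ) 0) :=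
            ENNReal.ofReal_le_ofReal (integral_mono hΦt hΦt.pos_part fun τ => le_max_left _ _)
        _ = ∫⁻ τ in Ioo 0 t, ENNReal.ofReal (max (Φ τ) 0) :=
            ofReal_integral_eq_lintegral_ofReal hΦt.pos_part
              (Eventually.of_forall fun τ => le_max_right _ _)
        _ = ∫⁻ τ in Ioo 0 t, ENNReal.ofReal (Φ τ) := lintegral_congr fun τ => by
            rcases le_total (Φ τ) 0 with h | h
            · rw [max_eq_right h, ENNReal.ofReal_zero, ENNReal.ofReal_of_nonpos h]
            · rw [max_eq_left h]
    have h2 : ∫⁻ τ in Ioo 0 t, ENNReal.ofReal (Φ τ) ≤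
        ∫⁻ τ in Ioo 0 t, aE τ * φE τ + ENNReal.ofReal ν⁻¹ * F τ := by
      refine lintegral_mono_ae ((ae_restrict_iff' measurableSet_Ioo).2 ?_)
      filter_upwards [hslice] with τ hτs hτ
      have hτs' : τ ∈ Ioo 0 s := ⟨hτ.1, hτ.2.trans_le ht.2⟩
      have hτT : τ ∈ Ioo 0 T := ⟨hτ.1, hτ.2.trans_le htT.2⟩
      have hτI : τ ∈ Icc 0 T := Ioo_subset_Icc_self hτT
      have hfint0 : 0 ≤ ∫ x, ‖f τ x‖ ^ 2 := integral_nonneg fun x => sq_nonneg _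
      by_cases hat : a τ = ⊤
      · by_cases hGz : G τ = 0
        · rw [hbad τ hτI hGz, ENNReal.ofReal_zero]; exact bot_le
        · have hGpos : 0 < G τ := lt_of_le_of_ne (hG0 τ) (Ne.symm hGz)
          have h1 : aE τ = ⊤ := by
            rw [haE]; simp only; rw [hat, ENNReal.mul_top (by norm_num)]
          have h2 : φE τ ≠ 0 := by
            rw [hφE]; simp only; rw [Ne, ENNReal.ofReal_eq_zero, not_le]; exact hGpos
          rw [h1, ENNReal.top_mul h2, top_add]; exact le_top
      calc ENNReal.ofReal (Φ τ)
          ≤ ENNReal.ofReal (2 * (a τ).toReal * G τ + ν⁻¹ * ∫ x, ‖f τ x‖ ^ 2) :=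
            ENNReal.ofReal_le_ofReal (hτs hτs' hat)
        _ ≤ ENNReal.ofReal (2 * (a τ).toReal * G τ) + ENNReal.ofReal (ν⁻¹ * ∫ x, ‖f τ x‖ ^ 2) :=
            ENNReal.ofReal_add_le
        _ = aE τ * φE τ + ENNReal.ofReal ν⁻¹ * ∫⁻ x, ‖f τ x‖ₑ ^ 2 := by
            rw [haE, hφE]; simp only
            rw [ENNReal.ofReal_mul (mul_nonneg zero_le_two ENNReal.toReal_nonneg),
              ENNReal.ofReal_mul zero_le_two, ENNReal.ofReal_ofNat, ENNReal.ofReal_toReal hat,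
              ENNReal.ofReal_mul (inv_nonneg.2 hν.le), hfsq τ hτI]
        _ ≤ aE τ * φE τ + ENNReal.ofReal ν⁻¹ * F τ := by gcongr; exact hF τ hτT
    have h3 : ∫⁻ τ in Ioo 0 t, aE τ * φE τ + ENNReal.ofReal ν⁻¹ * F τ ≤
        (∫⁻ τ in Ioo 0 t, aE τ * φE τ) + bS := by
      rw [lintegral_add_right _ (hFm.const_mul _), hbS_def, lintegral_const_mul _ hFm]
      have hmono : ∫⁻ τ in Ioo 0 t, F τ ≤ ∫⁻ τ in Ioo 0 s, F τ :=
        lintegral_mono_set (Ioo_subset_Ioo le_rfl ht.2)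
      gcongr
    calc φE t = ENNReal.ofReal (G 0 + ∫ τ in (0 : ℝ)..t, Φ τ) := by
          rw [hφE]; simp only; congr 1; exact hGb t htT
      _ ≤ ENNReal.ofReal (G 0) + ENNReal.ofReal (∫ τ in (0 : ℝ)..t, Φ τ) := ENNReal.ofReal_add_le
      _ = φE 0 + ENNReal.ofReal (∫ τ in Ioo 0 t, Φ τ) := by
          rw [intervalIntegral.integral_of_le ht.1, integral_Ioc_eq_integral_Ioo]
      _ ≤ φE 0 + ((∫⁻ τ in Ioo 0 t, aE τ * φE τ) + bS) := by gcongr; exact h1.trans (h2.trans h3)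
      _ = (φE 0 + bS) + ∫⁻ τ in Ioo 0 t, aE τ * φE τ := by ring
  have hBtop : φE 0 + bS ≠ ⊤ := ENNReal.add_ne_top.2 ⟨ENNReal.ofReal_ne_top, hbS⟩
  have hgron := lintegral_gronwall_le (S := s) hBtop
    (ENNReal.mul_ne_top (by norm_num) ENNReal.coe_ne_top) hM haS hineq s ⟨hs.1.le, le_rfl⟩
  -- unpack
  have hint_a : (∫⁻ τ in Ioo 0 s, aE τ).toReal =
      2 * (∫⁻ t in Ioo 0 s, a t).toReal := by
    rw [haE]; simp only
    rw [lintegral_const_mul' _ _ (by norm_num : (2 : ℝ≥0∞) ≠ ⊤), ENNReal.toReal_mul,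
      ENNReal.toReal_ofNat]
  rw [hint_a] at hgron
  rw [← hGeq s ⟨hs.1.le, hs.2⟩, ← hGeq 0 ⟨le_rfl, hT.le⟩, ← ENNReal.ofReal_inv_of_pos hν, mul_comm]
  convert hgron using 3

/-! ### §3 Beirão da Veiga's enstrophy inequality with a force -/

set_option maxHeartbeats 800000 in
/-- **Beirão da Veiga's enstrophy inequality WITH A FORCE** (Beirão da Veiga 1995; Berselli–Galdi
2002, (1.3); the forced twin of the tree's `bdv_enstrophy_le_mul_exp`). Let `(u, p)` be a classical
solution of the FORCED Navier–Stokes system on `[0, T] × ℝ³` (`ν > 0`) in Tao's class, `f(t), Df(t) ∈ L²`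
uniformly, `F ≥ ‖f(·)‖²₂` measurable; `3/2 < r < ∞`, `θ = 1 − 3/(2 r.toReal)` (`q = 1/θ`,
`2/q + 3/r = 2`); `0 < s ≤ T` with `∇u(t) ∈ L^r` for a.e. `t ∈ (0, s)`, `A = ∫₀ˢ ‖∇u‖_{L^r}^q < ∞`
and `∫₀ˢ F < ∞`. Then
`∫|∇u(s)|² ≤ exp(2 C(θ) (ν/2)^{1−q} A) (∫|∇u(0)|² + ν⁻¹ ∫₀ˢ F)`, `C(θ) = θ(2(1−θ))^{(1−θ)/θ}K^{2(1−θ)/θ}`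
— the device `enstrophy_le_mul_exp_forced_of_unforced` fed the tree's unforced slice bound
`integral_sum_inner_fderiv_le_of_momentum_of_gradient_eLpNorm` at viscosity `ν/2`.
[cite: BerselliGaldi2002, (1.3) p. 3586] [cite: LemarieRieusset2016, Thm. 11.2 (11.11)] -/
theorem bdv_enstrophy_le_mul_exp_forced {ν T : ℝ} (hν : 0 < ν) (hT : 0 < T)
    {u f : ℝ → EuclideanSpace ℝ (Fin 3) → EuclideanSpace ℝ (Fin 3)}
    {p : ℝ → EuclideanSpace ℝ (Fin 3) → ℝ} (hsol : FluidPDE.IsClassicalNSSolutionOn (Icc 0 T) ν f u p)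
    (hu : HasBoundedSobolevNormsOn (Icc 0 T) u)
    (hut : HasBoundedSobolevNormsOn (Icc 0 T) (FluidPDE.timeDerivWithin (Icc 0 T) u))
    (hp : ∀ n : ℕ, ∃ C : ℝ≥0, ∀ t ∈ Icc 0 T, ∫⁻ x, ‖iteratedFDeriv ℝ n (p t) x‖ₑ ^ 2 ≤ C)
    (hf : ∀ n : ℕ, n ≤ 1 → ∃ C : ℝ≥0, ∀ t ∈ Icc 0 T, ∫⁻ x, ‖iteratedFDeriv ℝ n (f t) x‖ₑ ^ 2 ≤ C)
    (F : ℝ → ℝ≥0∞) (hFm : Measurable F) (hF : ∀ t ∈ Ioo 0 T, ∫⁻ x, ‖f t x‖ₑ ^ 2 ≤ F t)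
    {r : ℝ≥0∞} (hr : 3 / 2 < r) (hrtop : r ≠ ⊤) {θ : ℝ} (hθ : θ = 1 - 3 / (2 * r.toReal))
    {s : ℝ} (hs : s ∈ Ioc 0 T)
    (hLr : ∀ᵐ t ∂volume, t ∈ Ioo 0 s → eLpNorm (fderiv ℝ (u t)) r volume < ⊤)
    (hA : ∫⁻ t in Ioo 0 s, ENNReal.ofReal ((eLpNorm (fderiv ℝ (u t)) r volume).toReal ^ (1 / θ)) ≠ ⊤)
    (hFs : ∫⁻ t in Ioo 0 s, F t ≠ ⊤) :
    ∫⁻ x, ENNReal.ofReal (FluidPDE.frobeniusNormSq (fderiv ℝ (u s) x)) ≤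
      ENNReal.ofReal (Real.exp (2 * ((θ * (2 * (1 - θ)) ^ ((1 - θ) / θ) *
          (SNormLESNormFDerivOfEqConst (EuclideanSpace ℝ (Fin 3))
            (volume : Measure (EuclideanSpace ℝ (Fin 3))) 2 : ℝ) ^ (2 * (1 - θ) / θ)) *
          (ν / 2) ^ (1 - 1 / θ) *
          (∫⁻ t in Ioo 0 s, ENNReal.ofReal
            ((eLpNorm (fderiv ℝ (u t)) r volume).toReal ^ (1 / θ))).toReal))) *
        ((∫⁻ x, ENNReal.ofReal (FluidPDE.frobeniusNormSq (fderiv ℝ (u 0) x))) +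
          (ENNReal.ofReal ν)⁻¹ * ∫⁻ t in Ioo 0 s, F t) := by
  set K : ℝ≥0 := SNormLESNormFDerivOfEqConst (EuclideanSpace ℝ (Fin 3))
    (volume : Measure (EuclideanSpace ℝ (Fin 3))) 2 with hK
  set C : ℝ := θ * (2 * (1 - θ)) ^ ((1 - θ) / θ) * (K : ℝ) ^ (2 * (1 - θ) / θ) with hC
  have hν2 : 0 < ν / 2 := half_pos hν
  -- the exponent
  have hρ3 : 3 / 2 < r.toReal := by
    have h : ((3 / 2 : ℝ≥0∞)).toReal < r.toReal :=
      (ENNReal.toReal_lt_toReal (ENNReal.div_ne_top (by norm_num) (by norm_num)) hrtop).2 hr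
    have h32 : ((3 / 2 : ℝ≥0∞)).toReal = 3 / 2 := by
      rw [ENNReal.toReal_div, ENNReal.toReal_ofNat, ENNReal.toReal_ofNat]
    rw [h32] at h
    exact h
  have hρ0 : 0 < r.toReal := by linarith
  have hθ0 : 0 < θ := by
    rw [hθ, sub_pos, div_lt_one (by positivity)]; linarith
  have hθ1 : θ < 1 := by
    rw [hθ]; linarith [div_pos (zero_lt_three' ℝ) (by positivity : (0 : ℝ) < 2 * r.toReal)]
  have hC0 : 0 ≤ C := by
    have : 0 ≤ 1 - θ := by linarith
    positivity
  have hc0 : 0 ≤ C * (ν / 2) ^ (1 - 1 / θ) := mul_nonneg hC0 (Real.rpow_nonneg hν2.le _)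
  -- the density
  set N : ℝ → ℝ := fun t => (eLpNorm (fderiv ℝ (u t)) r volume).toReal ^ (1 / θ) with hN
  have hN0 : ∀ t, 0 ≤ N t := fun t => Real.rpow_nonneg ENNReal.toReal_nonneg _
  set a : ℝ → ℝ≥0∞ := fun t => ENNReal.ofReal (C * (ν / 2) ^ (1 - 1 / θ)) * ENNReal.ofReal (N t)
    with ha
  have hat : ∀ t, a t ≠ ⊤ := fun t => ENNReal.mul_ne_top ENNReal.ofReal_ne_top ENNReal.ofReal_ne_top
  have hatr : ∀ t, (a t).toReal = C * (ν / 2) ^ (1 - 1 / θ) * N t := fun t => by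
    rw [ha]; simp only
    rw [ENNReal.toReal_mul, ENNReal.toReal_ofReal hc0, ENNReal.toReal_ofReal (hN0 t)]
  -- bounds from the class
  obtain ⟨B₀, hB₀⟩ := linfty_bound_of_hasBoundedSobolevNormsOn_holds
    (fun t ht => (hsol.contDiff_velocity ht).of_le (by norm_cast)) hu
  obtain ⟨B₁, -, hB₁⟩ := exists_forall_norm_fderiv_le_of_hasBoundedSobolevNormsOn
    (fun t ht => (hsol.contDiff_velocity ht).of_le (by norm_cast)) hu
  obtain ⟨C₁, hC₁⟩ := hu 1
  obtain ⟨D₂, hD₂⟩ := hu 2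
  obtain ⟨D₃, hD₃⟩ := hu 3
  obtain ⟨P₀, hP₀⟩ := hp 0
  obtain ⟨P₁, hP₁⟩ := hp 1
  have hzero' : ∀ {φ : EuclideanSpace ℝ (Fin 3) → ℝ} {C' : ℝ≥0},
      (∫⁻ x, ‖iteratedFDeriv ℝ 0 φ x‖ₑ ^ 2 ≤ C') → ∫⁻ x, ‖φ x‖ₑ ^ 2 < ⊤ := by
    intro φ C' h
    refine lt_of_le_of_lt ((le_of_eq (lintegral_congr fun x => ?_)).trans h) ENNReal.coe_lt_top
    rw [← ofReal_norm, ← ofReal_norm, norm_iteratedFDeriv_zero]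
  -- the unforced slice bound at viscosity `ν/2`, at a.e. time
  have hunf : ∀ᵐ t ∂volume, t ∈ Ioo 0 s → a t ≠ ⊤ →
      ∀ W₁ : EuclideanSpace ℝ (Fin 3) → EuclideanSpace ℝ (Fin 3), ContDiff ℝ 1 W₁ →
        (∀ x, W₁ x + FluidPDE.convect (u t) (u t) x = (ν / 2) • (Δ (u t)) x - gradient (p t) x) →
        ∫⁻ x, ‖W₁ x‖ₑ ^ 2 < ⊤ → ∫⁻ x, ‖iteratedFDeriv ℝ 1 W₁ x‖ₑ ^ 2 < ⊤ →
        ∫ x, ∑ i, ⟪fderiv ℝ (u t) x (EuclideanSpace.basisFun (Fin 3) ℝ i),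
            fderiv ℝ W₁ x (EuclideanSpace.basisFun (Fin 3) ℝ i)⟫ ≤
          (a t).toReal * ∫ x, FluidPDE.frobeniusNormSq (fderiv ℝ (u t) x) := by
    filter_upwards [hLr] with t hLrt hts _ W₁ hW₁ hmom₁ hW₁0 hW₁1
    have htI : t ∈ Icc 0 T := ⟨hts.1.le, hts.2.le.trans hs.2⟩
    have hsl := integral_sum_inner_fderiv_le_of_momentum_of_gradient_eLpNorm hν2
      ((hsol.contDiff_velocity htI).of_le (by norm_cast)) hW₁
      ((hsol.contDiff_pressure htI).of_le (by norm_cast)) hmom₁ (hsol.divFree t htI)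
      (fun x => hB₀ t htI x) (fun x => hB₁ t htI x) hr hrtop (hLrt hts) hθ
      ((hC₁ t htI).trans_lt ENNReal.coe_lt_top) ((hD₂ t htI).trans_lt ENNReal.coe_lt_top)
      ((hD₃ t htI).trans_lt ENNReal.coe_lt_top) hW₁0 hW₁1
      (hzero' (hP₀ t htI)) ((hP₁ t htI).trans_lt ENNReal.coe_lt_top)
    refine hsl.trans_eq ?_
    rw [hatr t]
  have hA' : ∫⁻ t in Ioo 0 s, a t ≠ ⊤ := by
    rw [ha]; simp only
    rw [lintegral_const_mul' _ _ ENNReal.ofReal_ne_top]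
    exact ENNReal.mul_ne_top ENNReal.ofReal_ne_top hA
  have hmain := enstrophy_le_mul_exp_forced_of_unforced hν hT hsol hu hut hp hf F hFm hF hs hunf hA' hFs
  have hint : (∫⁻ t in Ioo 0 s, a t).toReal = C * (ν / 2) ^ (1 - 1 / θ) *
      (∫⁻ t in Ioo 0 s, ENNReal.ofReal (N t)).toReal := by
    rw [ha]; simp only
    rw [lintegral_const_mul' _ _ ENNReal.ofReal_ne_top, ENNReal.toReal_mul, ENNReal.toReal_ofReal hc0]
  rw [hint] at hmain
  exact hmain

/-! ### §4 Miller's middle-eigenvalue enstrophy inequality with a force -/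

set_option maxHeartbeats 800000 in
/-- **Miller's middle-eigenvalue enstrophy inequality WITH A FORCE** (Miller 2020, Thm. 1.1 = Thm. 5.2;
Neustupa–Penel 2001; the forced twin of the tree's `miller_enstrophy_le_mul_exp`). Let `(u, p)` be a
classical solution of the FORCED system on `[0, T] × ℝ³` (`ν > 0`) in Tao's class, `f(t), Df(t) ∈ L²`
uniformly, `F ≥ ‖f(·)‖²₂` measurable; `3/2 < r < ∞`, `θ = 1 − 3/(2r)`; `m ≥ 0` a two-frame majorant of
the middle principal strain `λ₂(∇u(t,x))` at every `t ∈ (0, s)`, `0 < s ≤ T`, with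
`A = ∫₀ˢ (∫ m(t)^r)^{2/(2r−3)} < ∞` and `∫₀ˢ F < ∞`. Then
`∫|∇u(s)|² ≤ exp(2 (C(θ) 2^{1/θ} + 1) (ν/2)^{1−1/θ} A) (∫|∇u(0)|² + ν⁻¹∫₀ˢ F)` — the device fed the
tree's unforced slice bound `integral_sum_inner_fderiv_le_of_momentum_of_midStrain` at viscosity `ν/2`
(times with `∫ m(t)^r = ∞` carry an infinite density). [cite: Miller2019, Thm 1.1 (proof of Thm 5.2)]
[cite: NeustupaPenel2001, Thm 2] [cite: LemarieRieusset2016, Thm. 11.2 (11.11)] -/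
theorem miller_enstrophy_le_mul_exp_forced {ν T : ℝ} (hν : 0 < ν) (hT : 0 < T)
    {u f : ℝ → EuclideanSpace ℝ (Fin 3) → EuclideanSpace ℝ (Fin 3)}
    {p : ℝ → EuclideanSpace ℝ (Fin 3) → ℝ} (hsol : FluidPDE.IsClassicalNSSolutionOn (Icc 0 T) ν f u p)
    (hu : HasBoundedSobolevNormsOn (Icc 0 T) u)
    (hut : HasBoundedSobolevNormsOn (Icc 0 T) (FluidPDE.timeDerivWithin (Icc 0 T) u))
    (hp : ∀ n : ℕ, ∃ C : ℝ≥0, ∀ t ∈ Icc 0 T, ∫⁻ x, ‖iteratedFDeriv ℝ n (p t) x‖ₑ ^ 2 ≤ C)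
    (hf : ∀ n : ℕ, n ≤ 1 → ∃ C : ℝ≥0, ∀ t ∈ Icc 0 T, ∫⁻ x, ‖iteratedFDeriv ℝ n (f t) x‖ₑ ^ 2 ≤ C)
    (F : ℝ → ℝ≥0∞) (hFm : Measurable F) (hF : ∀ t ∈ Ioo 0 T, ∫⁻ x, ‖f t x‖ₑ ^ 2 ≤ F t)
    {r : ℝ} (hr : 3 / 2 < r) {θ : ℝ} (hθ : θ = 1 - 3 / (2 * r))
    {m : ℝ → EuclideanSpace ℝ (Fin 3) → ℝ} (hm0 : ∀ t x, 0 ≤ m t x)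
    {s : ℝ} (hs : s ∈ Ioc 0 T)
    (hmaj : ∀ t ∈ Ioo 0 s, ∀ x, ∃ y z : EuclideanSpace ℝ (Fin 3), ‖y‖ = 1 ∧ ‖z‖ = 1 ∧
      ⟪y, z⟫ = 0 ∧ ∀ α β : ℝ,
        ⟪fderiv ℝ (u t) x (α • y + β • z), α • y + β • z⟫ ≤ m t x * (α ^ 2 + β ^ 2))
    (hA : ∫⁻ t in Ioo 0 s, (∫⁻ x, ENNReal.ofReal (m t x) ^ r) ^ (2 / (2 * r - 3)) ≠ ⊤)
    (hFs : ∫⁻ t in Ioo 0 s, F t ≠ ⊤) :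
    ∫⁻ x, ENNReal.ofReal (FluidPDE.frobeniusNormSq (fderiv ℝ (u s) x)) ≤
      ENNReal.ofReal (Real.exp (2 * ((θ * (2 * (1 - θ)) ^ ((1 - θ) / θ) *
          (SNormLESNormFDerivOfEqConst (EuclideanSpace ℝ (Fin 3))
            (volume : Measure (EuclideanSpace ℝ (Fin 3))) 2 : ℝ) ^ (2 * (1 - θ) / θ) *
            (2 : ℝ) ^ (1 / θ) + 1) *
          (ν / 2) ^ (1 - 1 / θ) *
          (∫⁻ t in Ioo 0 s, (∫⁻ x, ENNReal.ofReal (m t x) ^ r) ^ (2 / (2 * r - 3))).toReal))) *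
        ((∫⁻ x, ENNReal.ofReal (FluidPDE.frobeniusNormSq (fderiv ℝ (u 0) x))) +
          (ENNReal.ofReal ν)⁻¹ * ∫⁻ t in Ioo 0 s, F t) := by
  set K : ℝ≥0 := SNormLESNormFDerivOfEqConst (EuclideanSpace ℝ (Fin 3))
    (volume : Measure (EuclideanSpace ℝ (Fin 3))) 2 with hK
  set C : ℝ := θ * (2 * (1 - θ)) ^ ((1 - θ) / θ) * (K : ℝ) ^ (2 * (1 - θ) / θ) *
    (2 : ℝ) ^ (1 / θ) with hC
  have hν2 : 0 < ν / 2 := half_pos hν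
  -- the exponents
  have hρ0 : 0 < r := by linarith
  have hθ0 : 0 < θ := by
    rw [hθ, sub_pos, div_lt_one (by positivity)]; linarith
  have hθ1 : θ < 1 := by
    rw [hθ]; linarith [div_pos (zero_lt_three' ℝ) (by positivity : (0 : ℝ) < 2 * r)]
  have hC0 : 0 ≤ C := by
    have : 0 ≤ 1 - θ := by linarith
    positivity
  have he0 : 0 < 2 / (2 * r - 3) := div_pos two_pos (by linarith)
  have hexp : 1 / r * (1 / θ) = 2 / (2 * r - 3) := by
    have h23 : (2 * r - 3) ≠ 0 := by
      have : 0 < 2 * r - 3 := by linarith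
      exact this.ne'
    have hθ' : θ = (2 * r - 3) / (2 * r) := by rw [hθ]; field_simp
    rw [hθ']
    field_simp
  have hνp : 0 < (ν / 2) ^ (1 - 1 / θ) := Real.rpow_pos_of_pos hν2 _
  have hc0 : 0 < (C + 1) * (ν / 2) ^ (1 - 1 / θ) := by positivity
  -- the density
  set Am : ℝ → ℝ≥0∞ := fun t => ∫⁻ x, ENNReal.ofReal (m t x) ^ r with hAm
  set Nq : ℝ → ℝ := fun t => ((Am t) ^ (1 / r)).toReal ^ (1 / θ) with hNq
  have hNq0 : ∀ t, 0 ≤ Nq t := fun t => Real.rpow_nonneg ENNReal.toReal_nonneg _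
  have hNqA : ∀ t, Am t ≠ ⊤ → ENNReal.ofReal (Nq t) = (Am t) ^ (2 / (2 * r - 3)) := by
    intro t ht
    have h1 : Nq t = ((Am t) ^ (2 / (2 * r - 3))).toReal := by
      rw [hNq]
      simp only
      rw [ENNReal.toReal_rpow, ← ENNReal.rpow_mul, hexp]
    rw [h1, ENNReal.ofReal_toReal]
    exact ENNReal.rpow_ne_top_of_nonneg he0.le ht
  set a : ℝ → ℝ≥0∞ := fun t => ENNReal.ofReal ((C + 1) * (ν / 2) ^ (1 - 1 / θ)) *
    (Am t) ^ (2 / (2 * r - 3)) with ha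
  have hAm_of_a : ∀ t, a t ≠ ⊤ → Am t ≠ ⊤ := by
    intro t hat hAt
    apply hat
    rw [ha]; simp only
    rw [hAt, ENNReal.top_rpow_of_pos he0, ENNReal.mul_top]
    rw [Ne, ENNReal.ofReal_eq_zero, not_le]; exact hc0
  have hatr : ∀ t, Am t ≠ ⊤ → (a t).toReal = (C + 1) * (ν / 2) ^ (1 - 1 / θ) * Nq t := fun t ht => by
    rw [ha]; simp only
    rw [ENNReal.toReal_mul, ENNReal.toReal_ofReal hc0.le, ← hNqA t ht, ENNReal.toReal_ofReal (hNq0 t)]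
  -- bounds from the class
  obtain ⟨B₀, hB₀⟩ := linfty_bound_of_hasBoundedSobolevNormsOn_holds
    (fun t ht => (hsol.contDiff_velocity ht).of_le (by norm_cast)) hu
  obtain ⟨B₁, -, hB₁⟩ := exists_forall_norm_fderiv_le_of_hasBoundedSobolevNormsOn
    (fun t ht => (hsol.contDiff_velocity ht).of_le (by norm_cast)) hu
  obtain ⟨C₁, hC₁⟩ := hu 1
  obtain ⟨D₂, hD₂⟩ := hu 2
  obtain ⟨D₃, hD₃⟩ := hu 3
  obtain ⟨P₀, hP₀⟩ := hp 0
  obtain ⟨P₁, hP₁⟩ := hp 1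
  have hzero' : ∀ {φ : EuclideanSpace ℝ (Fin 3) → ℝ} {C' : ℝ≥0},
      (∫⁻ x, ‖iteratedFDeriv ℝ 0 φ x‖ₑ ^ 2 ≤ C') → ∫⁻ x, ‖φ x‖ₑ ^ 2 < ⊤ := by
    intro φ C' h
    refine lt_of_le_of_lt ((le_of_eq (lintegral_congr fun x => ?_)).trans h) ENNReal.coe_lt_top
    rw [← ofReal_norm, ← ofReal_norm, norm_iteratedFDeriv_zero]
  -- the unforced slice bound at viscosity `ν/2`, at every time of finite density
  have hunf : ∀ᵐ t ∂volume, t ∈ Ioo 0 s → a t ≠ ⊤ →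
      ∀ W₁ : EuclideanSpace ℝ (Fin 3) → EuclideanSpace ℝ (Fin 3), ContDiff ℝ 1 W₁ →
        (∀ x, W₁ x + FluidPDE.convect (u t) (u t) x = (ν / 2) • (Δ (u t)) x - gradient (p t) x) →
        ∫⁻ x, ‖W₁ x‖ₑ ^ 2 < ⊤ → ∫⁻ x, ‖iteratedFDeriv ℝ 1 W₁ x‖ₑ ^ 2 < ⊤ →
        ∫ x, ∑ i, ⟪fderiv ℝ (u t) x (EuclideanSpace.basisFun (Fin 3) ℝ i),
            fderiv ℝ W₁ x (EuclideanSpace.basisFun (Fin 3) ℝ i)⟫ ≤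
          (a t).toReal * ∫ x, FluidPDE.frobeniusNormSq (fderiv ℝ (u t) x) := by
    refine Eventually.of_forall fun t hts hat W₁ hW₁ hmom₁ hW₁0 hW₁1 => ?_
    have htI : t ∈ Icc 0 T := ⟨hts.1.le, hts.2.le.trans hs.2⟩
    have hAt : Am t ≠ ⊤ := hAm_of_a t hat
    have hsl := integral_sum_inner_fderiv_le_of_momentum_of_midStrain hν2
      (hsol.contDiff_velocity htI) hW₁
      ((hsol.contDiff_pressure htI).of_le (by norm_cast)) hmom₁ (hsol.divFree t htI)
      (fun x => hB₀ t htI x) (fun x => hB₁ t htI x) hr hθ (hm0 t) (hmaj t hts) hAt.lt_top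
      ((hC₁ t htI).trans_lt ENNReal.coe_lt_top) ((hD₂ t htI).trans_lt ENNReal.coe_lt_top)
      ((hD₃ t htI).trans_lt ENNReal.coe_lt_top) hW₁0 hW₁1
      (hzero' (hP₀ t htI)) ((hP₁ t htI).trans_lt ENNReal.coe_lt_top)
    refine hsl.trans ?_
    rw [hatr t hAt]
    have hG0 : 0 ≤ ∫ x, FluidPDE.frobeniusNormSq (fderiv ℝ (u t) x) :=
      integral_nonneg fun x => FluidPDE.frobeniusNormSq_nonneg _
    have hid : (θ * (2 * (1 - θ)) ^ ((1 - θ) / θ) * (K : ℝ) ^ (2 * (1 - θ) / θ) *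
        (2 : ℝ) ^ (1 / θ)) * (ν / 2) ^ (1 - 1 / θ) *
        ((∫⁻ x, ENNReal.ofReal (m t x) ^ r) ^ (1 / r)).toReal ^ (1 / θ) =
        C * (ν / 2) ^ (1 - 1 / θ) * Nq t := by
      simp only [hC, hNq, hAm]
    rw [hid]
    have hNG : 0 ≤ (ν / 2) ^ (1 - 1 / θ) * Nq t * ∫ x, FluidPDE.frobeniusNormSq (fderiv ℝ (u t) x) :=
      mul_nonneg (mul_nonneg hνp.le (hNq0 t)) hG0
    nlinarith
  have hA' : ∫⁻ t in Ioo 0 s, a t ≠ ⊤ := by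
    rw [ha]; simp only
    rw [lintegral_const_mul' _ _ ENNReal.ofReal_ne_top]
    exact ENNReal.mul_ne_top ENNReal.ofReal_ne_top hA
  have hmain := enstrophy_le_mul_exp_forced_of_unforced hν hT hsol hu hut hp hf F hFm hF hs hunf hA' hFs
  have hint : (∫⁻ t in Ioo 0 s, a t).toReal = (C + 1) * (ν / 2) ^ (1 - 1 / θ) *
      (∫⁻ t in Ioo 0 s, (Am t) ^ (2 / (2 * r - 3))).toReal := by
    rw [ha]; simp only
    rw [lintegral_const_mul' _ _ ENNReal.ofReal_ne_top, ENNReal.toReal_mul, ENNReal.toReal_ofReal hc0.le]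
  rw [hint] at hmain
  exact hmain

end Slab

end Literature.Analysis.FluidPDE

end
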